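import Summits.QuantumAdvantage.AdviceFreeQNC0.WalkTube
import Summits.QuantumAdvantage.AdviceFreeQNC0.HammingLayerSums
import HarnessLib

/-!
# Cell qa-qnc0 (rung F-Q1, route `RingFrame`): THE TUBE BOUND — T11-2 `BallAveraging`
# (Hamming-ball double counting; qn-p2 ROUND-11 / `WalkTube.lean`)

PROVED: `BallCount.card_ball` — the Hamming ball of radius `r` in `{0,1}^m` has exactly
`N_r(m) = Σ_{j≤r} C(m,j)` (`Smolensky.numMonomials`) points (mismatch bijection onto the patterns of
weight `≤ r`, counted layer by layer with `Hegedus.card_layer`); and **`ballAveraging : BallAveraging`**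
(T11-2): `Σ_v |S ∩ B_r(v)| = |S|·N_r(m)`, so some centre `v` has `2^m·|S ∩ B_r(v)| ≥ |S|·N_r(m)`.
(T11-3 `tubeBound` was landed WITHOUT this step — via Nie–Wang, `WalkTubeRank.lean`; this file closes
the planner's typed target T11-2 for the record.)  Elementary ([folklore]).  WHAT THIS IS NOT: nothing on α.
-/

noncomputable section

open Classical

namespace Summit.QuantumAdvantage.AdviceFreeQNC0

open Finset
open Literature.Computability.MetaComplexity Literature.Computability.MetaComplexity.Smolensky

namespace BallCount

variable {m : ℕ}

/-- the mismatch pattern of `v` against `a`. -/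
def mis (a v : Fin m → Bool) : Fin m → Bool := fun i => decide (a i ≠ v i)

/-- `pdist a v = wt (mis a v)`. -/
theorem pdist_eq_wt_mis (a v : Fin m → Bool) : pdist a v = Hegedus.wt (mis a v) := by
  unfold pdist Hegedus.wt mis
  congr 1
  exact filter_congr fun i _ => by simp

/-- `mis a` is an involution-induced bijection: `mis a (mis a v) = v`… more simply it is injective. -/
theorem mis_injective (a : Fin m → Bool) : Function.Injective (mis a) := by
  intro v w h
  funext i
  have := congrFun h i
  unfold mis at this
  simp only [decide_eq_decide] at this
  cases ha : a i <;> cases hv : v i <;> cases hw : w i <;> simp_all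

/-- Patterns of weight `≤ r` number `N_r(m) = Σ_{j≤r} C(m,j)`. -/
theorem card_wt_le (m r : ℕ) :
    (univ.filter fun w : Fin m → Bool => Hegedus.wt w ≤ r).card = numMonomials m r := by
  have e : (univ.filter fun w : Fin m → Bool => Hegedus.wt w ≤ r) =
      (range (r + 1)).biUnion (Hegedus.layer m) := by
    ext w
    rw [mem_filter, mem_biUnion]
    constructor
    · intro h; exact ⟨Hegedus.wt w, mem_range.2 (Nat.lt_succ_of_le h.2), Hegedus.mem_layer_iff.2 rfl⟩
    · rintro ⟨j, hj, hw⟩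
      rw [Hegedus.mem_layer_iff] at hw
      exact ⟨mem_univ _, by rw [hw]; exact Nat.le_of_lt_succ (mem_range.1 hj)⟩
  rw [e, card_biUnion]
  · unfold numMonomials
    exact sum_congr rfl fun j _ => Hegedus.card_layer m j
  · intro j _ k _ hjk
    exact disjoint_left.2 fun w hw hw' =>
      hjk ((Hegedus.mem_layer_iff.1 hw).symm.trans (Hegedus.mem_layer_iff.1 hw'))

/-- **The Hamming ball of radius `r` has `N_r(m)` points.** -/
theorem card_ball (a : Fin m → Bool) (r : ℕ) :
    (univ.filter fun v : Fin m → Bool => pdist a v ≤ r).card = numMonomials m r := by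
  rw [← card_wt_le m r]
  refine card_bij (fun v _ => mis a v) (fun v hv => ?_) (fun v _ w _ h => mis_injective a h) (fun w hw => ?_)
  · rw [mem_filter] at hv ⊢
    exact ⟨mem_univ _, by rw [← pdist_eq_wt_mis]; exact hv.2⟩
  · refine ⟨mis a w, ?_, ?_⟩
    · rw [mem_filter] at hw ⊢
      refine ⟨mem_univ _, ?_⟩
      rw [pdist_eq_wt_mis]
      have : mis a (mis a w) = w := by
        funext i; unfold mis; cases a i <;> cases w i <;> simp
      rw [this]; exact hw.2
    · funext i; unfold mis; cases a i <;> cases w i <;> simp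

end BallCount

open BallCount in
/-- **T11-2 `BallAveraging` — PROVED** (double counting): `Σ_v |S ∩ B_r(v)| = |S|·N_r(m)`, so some
centre `v` has `2^m·|S ∩ B_r(v)| ≥ |S|·N_r(m)`. -/
theorem ballAveraging : BallAveraging := by
  intro m r S
  have hsum : ∑ v : Fin m → Bool, (S.filter fun a => pdist a v ≤ r).card = S.card * numMonomials m r := by
    simp only [card_filter]
    rw [sum_comm]
    have inner : ∀ a ∈ S, ∑ v : Fin m → Bool, (if pdist a v ≤ r then 1 else 0) = numMonomials m r := by
      intro a _
      rw [← card_filter]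
      exact card_ball a r
    rw [sum_congr rfl inner, sum_const, smul_eq_mul]
  have htot : ∑ _v : Fin m → Bool, S.card * numMonomials m r =
      ∑ v : Fin m → Bool, 2 ^ m * (S.filter fun a => pdist a v ≤ r).card := by
    rw [sum_const, card_univ, Fintype.card_fun, Fintype.card_bool, Fintype.card_fin, smul_eq_mul,
      ← mul_sum, hsum]
  obtain ⟨v, _, hv⟩ := exists_le_of_sum_le (univ_nonempty (α := Fin m → Bool)) htot.le
  exact ⟨v, hv⟩

end Summit.QuantumAdvantage.AdviceFreeQNC0

end
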